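import Literature.MathematicalPhysics.QuantumFieldTheory.Balaban1983to89.B15Claim189LambdaPin

/-!
# `Balaban1983to89.B15Claim189OmegaPPPin` — YM-DAG node N12 · [Balaban1989LargeFieldI] CMP **122** (1989) 175–202, p. 195 with (1.12) p. 179 and (1.88)–(1.89) p. 198:
# THE LETTERS `Ω″^∼_{h+1}` AND `Ω″^{∼2}_{h+1}` OF THE (1.89) SITUATION PINNED — `Ω″^∼_{h+1} = Ω^{∼6}_{h+1}`, `Ω″^{∼2}_{h+1} = Ω^{∼7}_{h+1}` over the enlargement of
# record — THE CUBE SIDES OF (1.3) ∕ (1.88) ∕ [III] (2.17) PINNED to def-R's `LM₂R_j`-partitions, and the p. 199 `j = h` ℍ-DOMAIN IDENTIFIED AS THE SIXTH CUBE LAYER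

statement-level bookkeeping over published theorems with citation tags; kernel-checked compositions of tree theorems; nothing here is a claim about the Yang–Mills
mass gap.

CITATION HEADER (lean-in-tree rule).  Source: [Balaban1989LargeFieldI] («[IV]»; page images `…-p004-x2.png`, `…-p005-x2.png`, `…-p021-x2.png`, `…-p024-x2.png` re-read by this
seat), verbatim: p. 195: *"Now we define the fluctuation field V′ on the set 𝔹″_k∩Λ∩Ω″^{∼2}_{h+1}. Let us recall that Ω″_{h+1} = Ω^{∼5}_{h+1} = Z′^{∼3}_h, hence Ω″^{∼2}_{h+1} = Ω^{∼7}_{h+1}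
= (Z′^∼_h)ᶜ, and denote Λ₀ = Λ∩Ω″^{∼2}_{h+1}"*; (1.12) p. 179: *"We define new domains Ω″_j by Ω″_j = (Z″ᶜ_j ∩ Z) ∪ (Ω_j ∩ Zᶜ) for j = k, k − 1, …, h + 1, Ω″_j = Ω_j for j = h,
h − 1, …, 1"*; (1.11) p. 179: *"Z″_j = (Ω_j^{∼5})ᶜ ∩ Z for j = k − N₀, k − N₀ − 1, …, k − N + 1 = h + 1"*; p. 179: *"the domains Ω_j^{∼n} are unions of L^{−(k−j)}MR_j-cubes of the
lattice T_η"*; p. 178: *"The cubes □ in (1.3) are the LM₂R_j-cubes of the partition of the lattice T_{L^{−j}}, or the L^{−(k−j)}LM₂R_j-cubes of the lattice T_η"*; p. 198: *"In the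
remaining components, which form a new domain Z, we have the function χ_{h,1/2}((Ω″^∼_{h+1})ᶜ∩Ω_h). … Take a cube □ ⊂ (Ω″^∼_{h+1})ᶜ∩Ω_h, and represent the functions U″_{k,Z} on □^∼ in the
usual way"*, *"the configuration (1↾_{Ω″^{∼2}_{h+1}}, V_h↾_{(Ω″^{∼2}_{h+1})ᶜ})"*; p. 199: *"The ℍ-function in the expansion can be bounded on the domain Z″_{j+1}∖Z″_j for h < j < k,
Z″_{h+1}∖(Ω″^∼_{h+1})ᶜ for j = h, and Ω^c_k∖Z″_k for j = k"*.  [Balaban1988Convergent] («[III]») (2.1) p. 254, (2.5) p. 255, (2.16)–(2.17) p. 257, p. 264–265 (*«surrounded by n layers»*).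
Seat `pub-ymgap-dag-n12-e` (YM-PLAN Track A, HUMAN RULING D-0062; director-ym R134 row N12 s3 «the (1.80)∕(1.89) + 𝐑′ (1.99)–(1.100) p. 201 chain»), generation 7, module 17.
BY NAME and UNCHANGED: p29's `B15Claim189Assembly` (`Setting189`, `half`, `domH`, `new189`, `chiPP`, `dom`), module 4 (`Node00.Sit189`), module 11 (`omegaOfChain`,
`Sit189.pinTerm`), module 13 (`zppOfChain` + `_mid` ∕ `_k₀succ`, `Sit189.pinZpp`), module 14 (`D189OfHist`, `sitOfHist`, `Sit189.pinLevels`, `ResidW.pinD189TH`), module 15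
(`Sit189.pinCubes ∕ pinDistAt`), module 16 (`enlD`, `subset_enlD`, `enlD_mono_layers`, `enlD_of_M_eq_zero`, `Sit189.pinLambda`, `ResidW.pinD189ΛH`, `claim189_sitOfHist_Λ_of_flow`,
`claim189_sitOfHist₁₃_Λ_of_inInterval`), def-R's `Node00.cubeSide ∕ cubeIndices ∕ cubeEnl ∕ plaqInside ∕ RkOfRecord` (`SmallFieldChiOfRecord`), dag-n11-e's
`B14SeparationOfRecord.one_le_RkOfRecord`.

WHY THIS FILE.  After module 16 every LOCATED-GEOMETRY input of the (1.89) display is a theorem, but two REGION LETTERS of the situation `σ : Sit189` were still residual DATA although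
print FIXES them: `OmT = Ω″^∼_{h+1}` (the region of the half-threshold functions `χ_{h,1/2}((Ω″^∼_{h+1})ᶜ∩Ω_h)` of (1.88)–(1.89) and of the p. 199 `j = h` ℍ-domain) and `ΩppT2 =
Ω″^{∼2}_{h+1}` (where the (1.93) comparison configuration `(1↾_{Ω″^{∼2}_{h+1}}, V_h↾)` is set to `1`, and where the (1.82) fluctuation bonds `𝔹₀ ⊂ Λ₀ = Λ∩Ω″^{∼2}_{h+1}` live).  Print,
p. 195: `Ω″_{h+1} = Ω^{∼5}_{h+1}`, hence — the enlargements being by layers of the SAME `𝐃_{h+1}`-cubes (p. 179) — `Ω″^∼_{h+1} = Ω^{∼6}_{h+1}` and `Ω″^{∼2}_{h+1} = Ω^{∼7}_{h+1}`: both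
are values of module 16's enlargement of record `enlD` at the term's (2.1)-chain.  Likewise the cube sides `sh`, `sk` of the `χ_{h,1/2}` ∕ `χ_h` and `χ_k(Ω_k^{∼4})` families were
residual numbers although print fixes them (p. 178: the `L^{−(k−j)}LM₂R_j`-cubes of `T_η`, i.e. def-R's `cubeSide L M₂ R_j j` fine sites — the side def-R's own `χ_k` of record uses).
THIS FILE types the two pins and certifies what follows by set algebra: the half domain is `(Ω^{∼6}_{h+1})ᶜ ∩ Ω_h`, hence inside the shell `Ω_h∖Ω_{h+1}`; the p. 199 `j = h`
ℍ-domain `Z″_{h+1}∖(Ω″^∼_{h+1})ᶜ` IS `(Ω^{∼6}_{h+1}∖Ω^{∼5}_{h+1}) ∩ Z ∩ Ω_h` — the SIXTH LAYER of `𝐃_{h+1}`-cubes around `Ω_{h+1}` inside `Z` (for `N > N₀`, print p. 179; EMPTY at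
`N = N₀`); the chain `Ω_{h+1} ⊆ Ω″_{h+1} ⊆ Ω″^∼_{h+1} ⊆ Ω″^{∼2}_{h+1}`; `0 < sh ⇐ 0 < M₂`.  After it, of the region letters of p29's `Setting189` at the record only the component union
`Z` (a (1.99) summation variable: term data) and module 13's interpolated `Z″_j`, `k₀ + 2 ≤ j ≤ k − 1` (print's *«complete these two sets to a sequence … in such a way that»*, p. 179 —
a separate module) are not objects of record.

* §1 GENERIC (any `Setting189`): `half_eq_of_OmT`, ★ `domH_eq_shell_of` (`OmT = E₆`, `Z″_{h+1} = E₅ᶜ ∩ Z` ⇒ `domH = (E₆∖E₅) ∩ Z ∩ Ω_h`), `domH_eq_empty_of` (`Z″_{h+1} = E₇ᶜ ∩ Z`,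
  `E₆ ⊆ E₇` ⇒ `domH = ∅`), `half_subset_shell_of` (`Ω_{h+1} ⊆ E₆` ⇒ `half ⊆ Ω_h∖Ω_{h+1}`), `disjoint_half_domH` (always).
* §2 THE PINS **`Node00.Sit189.pinOmegaPP σ s N enl`** (`OmT := enl 6 (h+1) Ω_{h+1}`, `ΩppT2 := enl 7 (h+1) Ω_{h+1}`, `h + 1 = k′ − N + 1`) and **`Node00.Sit189.pinSides σ ν g h k`**
  (`sh := cubeSide L M₂ R_h h`, `sk := cubeSide L M₂ R_k k`) + `rfl` faces and commutations; ORDER: both BEFORE module 7's χ′-pin (reads `ΩppT2`), module 15's cube pin (reads `sh`,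
  and `OmT` through its argument) and module 14's `D189OfHist` (whose `U_{h,□}((1,V_h))` reads `ΩppT2`, whose cube geometry reads `sh`, `sk`); `pinSides_sh_pos` (`0 < M₂ ⇒ 0 < sh`);
  `plaqT4_enl44_pinSides` (the `χ_k(Ω_k^{∼4})` cube geometry at the pinned `sk` IS def-R's `χ_k`-of-record geometry, `rfl`).
* §3 AT THE TERM'S FULLY PINNED SITUATION (module 16's stack with `σ` pre-pinned by §2, enlargement letter generic): `OmT_h_sitOfHist`, `sitOfHist_pinOmegaPP_regions`, `pinStack_sh_sk`, `half_sitOfHist_pinOmegaPP`,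
  ★ `domH_sitOfHist_pinOmegaPP_eq_shell` (`N₀ < N ≤ k′`), `domH_sitOfHist_pinOmegaPP_eq_empty` (`N = N₀`), `half_sitOfHist_pinOmegaPP_subset_shell`, `omega_subset_OmT_subset_ΩppT2_sitOfHist`.
* §4 OVER THE ENLARGEMENT OF RECORD `enlD` (`0 < M`): the same with `henl ∕ hmono` discharged (`…_enlD` forms).
* §5 THE (1.89) DISPLAY AT THE Ω″- AND SIDE-PINNED SITUATION: ★★★ `claim189_sitOfHist_ΛΩ_of_flow` and `claim189_sitOfHist₁₃_ΛΩ_of_inInterval` — module 16's theorems VERBATIM at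
  `σ := (σ.pinSides ν g (k′−N) k′).pinOmegaPP s N enlD`; `0 < sh` replaced by `0 < M₂`; EVERY region letter except `Z` and the interpolated `Z″_j` an object of record.
* §6 FOR dag-n12-d's λ-LAYER `ResidW.pinD189ΛH` (module 16 §9) with `σT` PRE-PINNED by §2: `rfl` faces `pinD189ΛH_letters_pre` and ★ `pinD189ΛH_domH_pre` (the run's `j = h`
  ℍ-domain is the sixth cube layer) — NO new layer name.
* §7 CENSUS (A2): at `M = 0` the pinned `Ω″`-letters are `∅` and the half domain is all of `Ω_h` (`0 < M` load-bearing); at `M₂ = 0` the pinned sides are `0`.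

LOCATED (nothing asserted): (i) print's identity `Ω″_{h+1} = Ω^{∼5}_{h+1}` (p. 195) combines (1.12) with (1.11) and presumes that the five-layer collar of `Ω_{h+1}` lies in `Z`
(in print `Ω^{∼5}_{h+1} = Z′^{∼3}_h`, the enlarged large-field region created at level `h`); the pin ADOPTS print's stated right-hand sides `Ω^{∼6}_{h+1}`, `Ω^{∼7}_{h+1}` as the values
of the letters — it does not derive them from a model of (1.12); (ii) as in module 16 LOCATED (i), `enlD n j` = def-T's `hullD` over the `𝐃_j`-cubes of record = print's `Ω_j^{∼n}`
when `Ω_j` is a union of `𝐃_j`-cubes (print's standing convention, [III] (2.1)); (iii) the level index is written `k′ − N + 1` (= `h + 1` by `rfl` at module 14's `h := k′ − N`; equal to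
`k′ + 1 − N` for `N ≤ k′`); (iv) p. 198's refinement *«the product over cubes □ intersecting the domain (Ω″^{∼2}_{h+1})ᶜ, and contained in Ω_h»* of the `χ_{h,1/2}` cube family is module
15's business (`pinCubes` takes the cubes MEETING `(Ω″^∼_{h+1})ᶜ ∩ Ω_h`); (v) the cube sides are print's `L^{j+1}M₂R_j` fine sites with `R_j = RkOfRecord L r g_j` of [III] (2.5) along
the history `g` — the nesting of these partitions with the `𝐃_j`- and `M₁`-partitions is node00-def's numeric admissibility ([DAGN11A-G2-READING-1-CUBESIDE]), not used here.

HONEST FRAMING.  Count-neutral: two data transformers and finite set algebra; NO estimate of Bałaban's asserted; N12 NOT discharged; one finite four-torus programme at fixed `ε`,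
Bałaban AS PRINTED with locators; nothing continuum ∕ ℝ⁴ ∕ OS ∕ mass gap ∕ Clay.  No `sorry`, no `axiom`, no `instance`, no `notation`.
-/

noncomputable section

open scoped BigOperators

namespace Literature.MathematicalPhysics.QuantumFieldTheory.Balaban1983to89

namespace B15Claim189OmegaPPPin

open DagBinding T4Continuum Node00
open B14DomainGeom (Pt)
open B8Eq17ClassAkV1 (plaqsOf)
open B14.Eq216Concrete (ukBox)
open B15Eq13Concrete (oneOn)
open B15Sect1ChartInstances (bondsB0)
open B15Claim189PrintedConditions (omegaOfChain omegaOfChain_succ_subset)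
open B15Claim189ZppPin (zppOfChain zppOfChain_mid zppOfChain_k₀succ)
open B15Claim189LambdaPin (enlD subset_enlD enlD_mono_layers enlD_of_M_eq_zero)

/-! ## §1. Generic: the half domain and the p. 199 `j = h` ℍ-domain of a (1.89) setting whose `Ω″^∼_{h+1}` and `Z″_{h+1}` are enlargement values -/

section Generic

open B15Claim189Assembly (Setting189 half domH)

variable {P : Params} {G C ι : Type*}

/-- The half domain `(Ω″^∼_{h+1})ᶜ ∩ Ω_h` of (1.88)–(1.89) read at a value `E₆` of the letter `Ω″^∼_{h+1}`. [cite: Balaban1989LargeFieldI, (1.89) p.198, p.195] -/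
theorem half_eq_of_OmT (D : Setting189 P G C ι) {E₆ : Set (Site P 0)} (hOmT : D.OmT = E₆) : half D = E₆ᶜ ∩ D.Ω D.h := by
  unfold half; rw [hOmT]

/-- ★ **THE `j = h` ℍ-DOMAIN IS A SHELL**: if `Ω″^∼_{h+1} = E₆` and `Z″_{h+1} = E₅ᶜ ∩ Z`, then p. 199's *«Z″_{h+1}∖(Ω″^∼_{h+1})ᶜ for j = h»* (p29's `domH = Z″_{h+1} ∩ Ω_h ∩ Ω″^∼_{h+1}`)
is `(E₆ ∖ E₅) ∩ Z ∩ Ω_h` — at print's values `E₅ = Ω^{∼5}_{h+1}`, `E₆ = Ω^{∼6}_{h+1}` the SIXTH LAYER of `𝐃_{h+1}`-cubes around `Ω_{h+1}`, inside `Z ∩ Ω_h`.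
[cite: Balaban1989LargeFieldI, p.199, (1.11) p.179, p.195] -/
theorem domH_eq_shell_of (D : Setting189 P G C ι) {E₅ E₆ Z : Set (Site P 0)} (hOmT : D.OmT = E₆) (hZpp : D.Zpp (D.h + 1) = E₅ᶜ ∩ Z) :
    domH D = (E₆ \ E₅) ∩ Z ∩ D.Ω D.h := by
  unfold domH; rw [hOmT, hZpp]
  ext x
  constructor
  · rintro ⟨⟨⟨h5, hZ⟩, hΩ⟩, h6⟩
    exact ⟨⟨⟨h6, h5⟩, hZ⟩, hΩ⟩
  · rintro ⟨⟨⟨h6, h5⟩, hZ⟩, hΩ⟩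
    exact ⟨⟨⟨h5, hZ⟩, hΩ⟩, h6⟩

/-- **AT `N = N₀` THE `j = h` ℍ-DOMAIN IS EMPTY**: if `Ω″^∼_{h+1} = E₆`, `Z″_{h+1} = E₇ᶜ ∩ Z` (the (1.10) case `h + 1 = k₀ + 1`) and `E₆ ⊆ E₇`, then `domH = ∅`.
[cite: Balaban1989LargeFieldI, p.199, (1.10) p.179, p.195] -/
theorem domH_eq_empty_of (D : Setting189 P G C ι) {E₆ E₇ Z : Set (Site P 0)} (hOmT : D.OmT = E₆) (hZpp : D.Zpp (D.h + 1) = E₇ᶜ ∩ Z) (h67 : E₆ ⊆ E₇) :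
    domH D = ∅ := by
  unfold domH; rw [hOmT, hZpp, Set.eq_empty_iff_forall_notMem]
  rintro x ⟨⟨⟨hx7, -⟩, -⟩, hx6⟩
  exact hx7 (h67 hx6)

/-- **THE HALF DOMAIN LIES IN THE SHELL `Ω_h∖Ω_{h+1}`** as soon as `Ω_{h+1} ⊆ Ω″^∼_{h+1}` (print: cubes *«contained in Ω_h»* and outside `Ω″^∼_{h+1} ⊇ Ω_{h+1}`).
[cite: Balaban1989LargeFieldI, (1.89) p.198, p.195] -/
theorem half_subset_shell_of (D : Setting189 P G C ι) {E₆ : Set (Site P 0)} (hOmT : D.OmT = E₆) (hΩ : D.Ω (D.h + 1) ⊆ E₆) :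
    half D ⊆ D.Ω D.h \ D.Ω (D.h + 1) := by
  rw [half_eq_of_OmT D hOmT]
  rintro x ⟨hx6, hxh⟩
  exact ⟨hxh, fun h => hx6 (hΩ h)⟩

/-- The half domain (outside `Ω″^∼_{h+1}`) and the `j = h` ℍ-domain (inside it) are DISJOINT — for every setting. [cite: Balaban1989LargeFieldI, p.199, (1.89) p.198] -/
theorem disjoint_half_domH (D : Setting189 P G C ι) : Disjoint (half D) (domH D) := by
  rw [Set.disjoint_left]
  rintro x ⟨hxT, -⟩ ⟨-, hxT'⟩
  exact hxT hxT'

end Generic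

/-! ## §2. THE PINS: `Ω″^∼_{h+1} := Ω^{∼6}_{h+1}`, `Ω″^{∼2}_{h+1} := Ω^{∼7}_{h+1}` (p. 195 with (1.12)); `sh, sk :=` def-R's `LM₂R_h`-, `LM₂R_k`-cube sides (p. 178) -/

section Pin

variable {F : T4Family} {N : ℕ} [NeZero N]

/-- **THE (1.89) SITUATION WITH ITS LETTERS `Ω″^∼_{h+1}`, `Ω″^{∼2}_{h+1}` PINNED** (p. 195, verbatim: *«recall that Ω″_{h+1} = Ω^{∼5}_{h+1} = Z′^{∼3}_h, hence Ω″^{∼2}_{h+1} = Ω^{∼7}_{h+1}»*;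
the enlargements `∼n` of p. 179 are by `n` layers of `𝐃_{h+1}`-cubes, so `Ω″^∼_{h+1} = Ω^{∼6}_{h+1}`): `OmT := enl 6 (h+1) Ω_{h+1}`, `ΩppT2 := enl 7 (h+1) Ω_{h+1}` with `h + 1 := k′ − N + 1`
(module 14's `h = k′ − N`), `Ω_j` the term's clamped chain `omegaOfChain s j` (module 11), `enl` an enlargement (module 16's `enlD`, or a letter).  ORDER: before module 7's χ′-pin, module
15's cube pin and module 14's `D189OfHist`, which READ these letters; independent of the term ∕ levels ∕ `Λ` ∕ `Z″` ∕ distance pins.  Data, no law.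
[cite: Balaban1989LargeFieldI, p.195, (1.12) p.179, (1.89) p.198] -/
def _root_.Literature.MathematicalPhysics.QuantumFieldTheory.Balaban1983to89.Node00.Sit189.pinOmegaPP {K : ℕ} (σ : Sit189 F N K)
    {D : ℕ → Set (Set (Site (F.P K) 0))} {k' : ℕ} (s : B14.Eq218Concrete.Seq D k') (Nm : ℕ) (enl : ℕ → ℕ → Set (Site (F.P K) 0) → Set (Site (F.P K) 0)) : Sit189 F N K :=
  { σ with
    OmT := enl 6 (k' - Nm + 1) (omegaOfChain s (k' - Nm + 1))
    ΩppT2 := enl 7 (k' - Nm + 1) (omegaOfChain s (k' - Nm + 1)) }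

/-- **THE (1.89) SITUATION WITH ITS CUBE SIDES PINNED** (p. 178, verbatim: *«The cubes □ in (1.3) are the LM₂R_j-cubes of the partition of the lattice T_{L^{−j}}, or the L^{−(k−j)}LM₂R_j-cubes
of the lattice T_η»*; (1.88) p. 198 at `j = h`; [III] (2.17) at `j = k`): `sh := cubeSide L M₂ R_h h`, `sk := cubeSide L M₂ R_k k` fine sites (def-R's `cubeSide`, `R_j = RkOfRecord L r g_j`
of [III] (2.5) along the history `g`), at levels `h`, `k` given as arguments (the caller passes `k′ − N`, `k′`).  ORDER: before module 15's cube pin and module 14's `D189OfHist`, which read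
`sh`, `sk`.  Data, no law. [cite: Balaban1989LargeFieldI, p.178, (1.88) p.198; Balaban1988Convergent, (2.5) p.255, (2.17) p.257] -/
def _root_.Literature.MathematicalPhysics.QuantumFieldTheory.Balaban1983to89.Node00.Sit189.pinSides {K : ℕ} (σ : Sit189 F N K) (ν : Stage7Numerics) (g : ℕ → ℝ) (h k : ℕ) :
    Sit189 F N K :=
  { σ with
    sh := cubeSide (F.P K).L ν.M₂ (RkOfRecord (F.P K).L ν.r (g h)) h
    sk := cubeSide (F.P K).L ν.M₂ (RkOfRecord (F.P K).L ν.r (g k)) k }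

variable {K : ℕ} (σ : Sit189 F N K) {D : ℕ → Set (Set (Site (F.P K) 0))} {k' : ℕ} (s : B14.Eq218Concrete.Seq D k') (Nm : ℕ)
  (enl : ℕ → ℕ → Set (Site (F.P K) 0) → Set (Site (F.P K) 0)) (ν : Stage7Numerics) (g : ℕ → ℝ) (h k : ℕ)

/-- The pinned letters (`rfl` ×2). [cite: Balaban1989LargeFieldI, p.195 (bookkeeping)] -/
theorem pinOmegaPP_OmT_ΩppT2 : (σ.pinOmegaPP s Nm enl).OmT = enl 6 (k' - Nm + 1) (omegaOfChain s (k' - Nm + 1)) ∧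
    (σ.pinOmegaPP s Nm enl).ΩppT2 = enl 7 (k' - Nm + 1) (omegaOfChain s (k' - Nm + 1)) := ⟨rfl, rfl⟩

/-- The `Ω″`-pin keeps every other field (`rfl`; `HEq` for the chart letter). [cite: Balaban1989LargeFieldI, (1.89) p.198 (bookkeeping)] -/
theorem pinOmegaPP_kept : (σ.pinOmegaPP s Nm enl).𝔤 = σ.𝔤 ∧ HEq (σ.pinOmegaPP s Nm enl).chiP σ.chiP ∧ (σ.pinOmegaPP s Nm enl).h = σ.h ∧ (σ.pinOmegaPP s Nm enl).k₀ = σ.k₀ ∧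
    (σ.pinOmegaPP s Nm enl).k = σ.k ∧ (σ.pinOmegaPP s Nm enl).sh = σ.sh ∧ (σ.pinOmegaPP s Nm enl).sk = σ.sk ∧ (σ.pinOmegaPP s Nm enl).Ω = σ.Ω ∧
    (σ.pinOmegaPP s Nm enl).Zpp = σ.Zpp ∧ (σ.pinOmegaPP s Nm enl).Z = σ.Z ∧ (σ.pinOmegaPP s Nm enl).Λ = σ.Λ ∧ (σ.pinOmegaPP s Nm enl).β = σ.β ∧
    (σ.pinOmegaPP s Nm enl).L₀ = σ.L₀ ∧ (σ.pinOmegaPP s Nm enl).α = σ.α ∧ (σ.pinOmegaPP s Nm enl).δ = σ.δ ∧ (σ.pinOmegaPP s Nm enl).B₃ = σ.B₃ ∧ (σ.pinOmegaPP s Nm enl).B₅ = σ.B₅ ∧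
    (σ.pinOmegaPP s Nm enl).M = σ.M ∧ (σ.pinOmegaPP s Nm enl).O1 = σ.O1 ∧ (σ.pinOmegaPP s Nm enl).dist = σ.dist ∧ (σ.pinOmegaPP s Nm enl).Xhalf = σ.Xhalf ∧
    (σ.pinOmegaPP s Nm enl).XH = σ.XH ∧ (σ.pinOmegaPP s Nm enl).XΩ4 = σ.XΩ4 ∧ (σ.pinOmegaPP s Nm enl).boxOf = σ.boxOf ∧ (σ.pinOmegaPP s Nm enl).dev0 = σ.dev0 ∧
    (σ.pinOmegaPP s Nm enl).devV'' = σ.devV'' ∧ (σ.pinOmegaPP s Nm enl).dev97 = σ.dev97 :=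
  ⟨rfl, HEq.rfl, rfl, rfl, rfl, rfl, rfl, rfl, rfl, rfl, rfl, rfl, rfl, rfl, rfl, rfl, rfl, rfl, rfl, rfl, rfl, rfl, rfl, rfl, rfl, rfl, rfl⟩

/-- The `Ω″`-pin commutes with the term, levels, `Λ`, `Z″`, distance, cube and side pins (`rfl`: disjoint fields) — NOT with module 7's χ′-pin, which READS `ΩppT2` and comes AFTER it.
[cite: Balaban1989LargeFieldI, (1.89) p.198 (bookkeeping)] -/
theorem pinOmegaPP_comm (M Nm' N₀ N₀' Nm'' kd : ℕ) (S : Set (Site (F.P K) 0)) (enl' : ℕ → ℕ → Set (Site (F.P K) 0) → Set (Site (F.P K) 0)) :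
    (σ.pinOmegaPP s Nm enl).pinTerm s = (σ.pinTerm s).pinOmegaPP s Nm enl ∧ (σ.pinOmegaPP s Nm enl).pinLevels M Nm' N₀ = (σ.pinLevels M Nm' N₀).pinOmegaPP s Nm enl ∧
    (σ.pinOmegaPP s Nm enl).pinLambda s N₀' enl' = (σ.pinLambda s N₀' enl').pinOmegaPP s Nm enl ∧
    (σ.pinOmegaPP s Nm enl).pinZpp s N₀' Nm'' enl' = (σ.pinZpp s N₀' Nm'' enl').pinOmegaPP s Nm enl ∧ (σ.pinOmegaPP s Nm enl).pinDistAt kd = (σ.pinDistAt kd).pinOmegaPP s Nm enl ∧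
    (σ.pinOmegaPP s Nm enl).pinCubes S = (σ.pinCubes S).pinOmegaPP s Nm enl ∧ (σ.pinOmegaPP s Nm enl).pinSides ν g h k = (σ.pinSides ν g h k).pinOmegaPP s Nm enl :=
  ⟨rfl, rfl, rfl, rfl, rfl, rfl, rfl⟩

/-- After the `Ω″`-pin, module 7's (1.82) letter READS THE PINNED `Ω″^{∼2}_{h+1}` (its bond family `𝔹₀ ⊂ Λ₀ = Λ ∩ Ω″^{∼2}_{h+1}`, p. 195) (`Iff.rfl`).
[cite: Balaban1989LargeFieldI, (1.82) p.196, p.195 (bookkeeping)] -/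
theorem pinOmegaPP_then_pinChi182 (δ' : ℝ) (B' : (j : ℕ) → VecField (F.P K) j (EuclideanSpace ℝ (Fin (N ^ 2 - 1)))) :
    ((σ.pinOmegaPP s Nm enl).pinChi182 δ').chiP B' ↔
      ∀ j, ∀ b ∈ bondsB0 σ.Ω σ.Zpp σ.Z σ.Λ (enl 7 (k' - Nm + 1) (omegaOfChain s (k' - Nm + 1))) σ.h σ.k j, ‖B' j b‖ < δ' := Iff.rfl

/-- The pinned sides (`rfl` ×2). [cite: Balaban1989LargeFieldI, p.178 (bookkeeping)] -/
theorem pinSides_sh_sk : (σ.pinSides ν g h k).sh = cubeSide (F.P K).L ν.M₂ (RkOfRecord (F.P K).L ν.r (g h)) h ∧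
    (σ.pinSides ν g h k).sk = cubeSide (F.P K).L ν.M₂ (RkOfRecord (F.P K).L ν.r (g k)) k := ⟨rfl, rfl⟩

/-- The side pin keeps every other field (`rfl`; `HEq` for the chart letter). [cite: Balaban1989LargeFieldI, (1.89) p.198 (bookkeeping)] -/
theorem pinSides_kept : (σ.pinSides ν g h k).𝔤 = σ.𝔤 ∧ HEq (σ.pinSides ν g h k).chiP σ.chiP ∧ (σ.pinSides ν g h k).h = σ.h ∧ (σ.pinSides ν g h k).k₀ = σ.k₀ ∧ (σ.pinSides ν g h k).k = σ.k ∧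
    (σ.pinSides ν g h k).Ω = σ.Ω ∧ (σ.pinSides ν g h k).Zpp = σ.Zpp ∧ (σ.pinSides ν g h k).Z = σ.Z ∧ (σ.pinSides ν g h k).Λ = σ.Λ ∧ (σ.pinSides ν g h k).OmT = σ.OmT ∧
    (σ.pinSides ν g h k).ΩppT2 = σ.ΩppT2 ∧ (σ.pinSides ν g h k).β = σ.β ∧ (σ.pinSides ν g h k).L₀ = σ.L₀ ∧ (σ.pinSides ν g h k).α = σ.α ∧ (σ.pinSides ν g h k).δ = σ.δ ∧
    (σ.pinSides ν g h k).B₃ = σ.B₃ ∧ (σ.pinSides ν g h k).B₅ = σ.B₅ ∧ (σ.pinSides ν g h k).M = σ.M ∧ (σ.pinSides ν g h k).O1 = σ.O1 ∧ (σ.pinSides ν g h k).dist = σ.dist ∧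
    (σ.pinSides ν g h k).Xhalf = σ.Xhalf ∧ (σ.pinSides ν g h k).XH = σ.XH ∧ (σ.pinSides ν g h k).XΩ4 = σ.XΩ4 ∧ (σ.pinSides ν g h k).boxOf = σ.boxOf ∧ (σ.pinSides ν g h k).dev0 = σ.dev0 ∧
    (σ.pinSides ν g h k).devV'' = σ.devV'' ∧ (σ.pinSides ν g h k).dev97 = σ.dev97 :=
  ⟨rfl, HEq.rfl, rfl, rfl, rfl, rfl, rfl, rfl, rfl, rfl, rfl, rfl, rfl, rfl, rfl, rfl, rfl, rfl, rfl, rfl, rfl, rfl, rfl, rfl, rfl, rfl, rfl⟩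

/-- The side pin commutes with the term, levels, `Λ`, `Z″` and distance pins (`rfl`) — NOT with module 15's cube pin, which READS `sh` and comes AFTER it.
[cite: Balaban1989LargeFieldI, (1.88) p.198 (bookkeeping)] -/
theorem pinSides_comm (M Nm' N₀ N₀' Nm'' kd : ℕ) (enl' : ℕ → ℕ → Set (Site (F.P K) 0) → Set (Site (F.P K) 0)) :
    (σ.pinSides ν g h k).pinTerm s = (σ.pinTerm s).pinSides ν g h k ∧ (σ.pinSides ν g h k).pinLevels M Nm' N₀ = (σ.pinLevels M Nm' N₀).pinSides ν g h k ∧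
    (σ.pinSides ν g h k).pinLambda s N₀' enl' = (σ.pinLambda s N₀' enl').pinSides ν g h k ∧
    (σ.pinSides ν g h k).pinZpp s N₀' Nm'' enl' = (σ.pinZpp s N₀' Nm'' enl').pinSides ν g h k ∧ (σ.pinSides ν g h k).pinDistAt kd = (σ.pinDistAt kd).pinSides ν g h k :=
  ⟨rfl, rfl, rfl, rfl, rfl⟩

/-- def-R's `LM₂R_j`-cube side is positive for `0 < M₂` (`L ≥ 1`, `R_j ≥ 1`). [cite: Balaban1988Convergent, (2.17) p.257, (2.5) p.255 (bookkeeping)] -/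
theorem cubeSide_pos {L : ℕ} (hL : 1 ≤ L) {M₂ : ℕ} (hM₂ : 0 < M₂) (r : ℕ) (x : ℝ) (j : ℕ) : 0 < cubeSide L M₂ (RkOfRecord L r x) j := by
  unfold cubeSide
  exact Nat.mul_pos (Nat.mul_pos (Nat.pow_pos (by omega)) hM₂) (B14SeparationOfRecord.one_le_RkOfRecord hL r x)

/-- **`0 < sh` ⇐ `0 < M₂`** at the pinned sides: module 15's ∕ 16's displayed `0 < σ.sh` becomes a condition on the numerics of record. [cite: Balaban1989LargeFieldI, (1.88) p.198; Balaban1988Convergent, (2.17) p.257] -/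
theorem pinSides_sh_pos (hM₂ : 0 < ν.M₂) : 0 < (σ.pinSides ν g h k).sh ∧ 0 < (σ.pinSides ν g h k).sk :=
  ⟨cubeSide_pos (F.P K).L_pos hM₂ ν.r (g h) h, cubeSide_pos (F.P K).L_pos hM₂ ν.r (g k) k⟩

/-- **THE `χ_k(Ω_k^{∼4})` CUBE GEOMETRY AT THE PINNED `sk` IS def-R's `χ_k`-OF-RECORD GEOMETRY**: the plaquette family `plaqInside (□^∼)` and the domain `□^{∼4}` over the `cubeSide L M₂ R_k k`-
partition that module 14's `D189OfHist` builds from `sk` are the ones of def-R's `chiOfRecord` at step `k` (`rfl` ×2). [cite: Balaban1988Convergent, (2.16)–(2.17) p.257 (objects of record)] -/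
theorem plaqT4_enl44_pinSides :
    (fun a => plaqInside (cubeEnl (F.P K) (σ.pinSides ν g h k).sk a 1)) = (fun a => plaqInside (cubeEnl (F.P K) (cubeSide (F.P K).L ν.M₂ (RkOfRecord (F.P K).L ν.r (g k)) k) a 1)) ∧
    (fun a => cubeEnl (F.P K) (σ.pinSides ν g h k).sk a 4) = (fun a => cubeEnl (F.P K) (cubeSide (F.P K).L ν.M₂ (RkOfRecord (F.P K).L ν.r (g k)) k) a 4) := ⟨rfl, rfl⟩

end Pin

/-! ## §3. At the term's fully pinned situation (module 16's stack, `σ` pre-pinned): the half domain and the `j = h` ℍ-domain are OBJECTS OF RECORD -/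

section Term

open B15Claim189Assembly (Setting189 half domH)
open B15Claim189PinsOfHistory (D189OfHist sitOfHist)
open B15DeterminingSets (MSField)

variable {F : T4Family} {N : ℕ} [NeZero N] {ν : Stage7Numerics} {A₁ : ℝ} {M : ℕ} (Nm : ℕ) (P : B12.RunParams) (σ : Sit189 F N P.K) {g : ℕ → ℝ} {k' : ℕ}
  (s : SeqOfRecord F ν M g P.K k') (N₀ p₁ kd : ℕ) (S : Set (Site (F.P P.K) 0)) (enl enl' : ℕ → ℕ → Set (Site (F.P P.K) 0) → Set (Site (F.P P.K) 0))

/-- At the term's fully pinned situation built over the `Ω″`-pinned `σ` (then module 16's `Λ` pin, module 15's distance, module 13's `Z″`, module 15's cubes; then — inside `sitOfHist` — the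
term, levels, χ′ and `dev0` pins), the letter `Ω″^∼_{h+1}` of `D = D189OfHist …` IS `Ω^{∼6}_{h+1}` of the chain, `h = k′ − N` (`rfl` ×2). [cite: Balaban1989LargeFieldI, p.195, (1.12) p.179, (1.89) p.198] -/
theorem OmT_h_sitOfHist
    {D : Setting189 (F.P P.K) (SU N) (MSField (F.P P.K) (SU N) × ((j : ℕ) → VecField (F.P P.K) j (EuclideanSpace ℝ (Fin (N ^ 2 - 1))))) (Pt (F.P P.K).d)}
    (hD : D = D189OfHist ν P (sitOfHist ν A₁ M Nm P (((((σ.pinOmegaPP s Nm enl).pinLambda s N₀ enl').pinDistAt kd).pinZpp s N₀ Nm enl').pinCubes S) g s N₀ p₁) g) :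
    D.OmT = enl 6 (k' - Nm + 1) (omegaOfChain s (k' - Nm + 1)) ∧ D.h = k' - Nm := by
  subst hD; exact ⟨rfl, rfl⟩

/-- The fully pinned SITUATION carries `Ω″^∼_{h+1} = Ω^{∼6}_{h+1}` and `Ω″^{∼2}_{h+1} = Ω^{∼7}_{h+1}` through every later pin (`rfl` ×2); by module 14's `D189OfHist_Uhalf` the (1.93)
comparison configuration `U_{h,□}((1, V_h))` of the letters is then r11's `ukBox` with the field set to `1` ON `Ω^{∼7}_{h+1}` — print p. 198 *«the configuration (1↾_{Ω″^{∼2}_{h+1}},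
V_h↾_{(Ω″^{∼2}_{h+1})ᶜ})»* at objects of record — and by module 14's `sitOfHist_chiP_iff` the (1.82) bond family `𝔹₀ ⊂ Λ ∩ Ω″^{∼2}_{h+1}` reads `Ω^{∼7}_{h+1}`.
[cite: Balaban1989LargeFieldI, p.195, p.198, (1.81)–(1.82) pp.195–196; Balaban1988Convergent, (2.16) p.257] -/
theorem sitOfHist_pinOmegaPP_regions {σ' : Sit189 F N P.K}
    (hσ : σ' = sitOfHist ν A₁ M Nm P (((((σ.pinOmegaPP s Nm enl).pinLambda s N₀ enl').pinDistAt kd).pinZpp s N₀ Nm enl').pinCubes S) g s N₀ p₁) :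
    σ'.OmT = enl 6 (k' - Nm + 1) (omegaOfChain s (k' - Nm + 1)) ∧ σ'.ΩppT2 = enl 7 (k' - Nm + 1) (omegaOfChain s (k' - Nm + 1)) := by
  subst hσ; exact ⟨rfl, rfl⟩

/-- The pin stack below `sitOfHist` keeps the cube sides (`rfl` ×2; module 14's `sitOfHist_dev0_cubes` carries them through `sitOfHist`), so a side pin `σ := σ₀.pinSides ν g h k` placed
first is what module 14's cube geometry reads. [cite: Balaban1989LargeFieldI, p.178, (1.88) p.198 (bookkeeping)] -/
theorem pinStack_sh_sk : (((((σ.pinOmegaPP s Nm enl).pinLambda s N₀ enl').pinDistAt kd).pinZpp s N₀ Nm enl').pinCubes S).sh = σ.sh ∧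
    (((((σ.pinOmegaPP s Nm enl).pinLambda s N₀ enl').pinDistAt kd).pinZpp s N₀ Nm enl').pinCubes S).sk = σ.sk := ⟨rfl, rfl⟩

/-- **THE HALF DOMAIN IS AN OBJECT OF RECORD**: `half D = (Ω^{∼6}_{h+1})ᶜ ∩ Ω_h` (the chain's `Ω`, `h = k′ − N`). [cite: Balaban1989LargeFieldI, (1.88)–(1.89) p.198, p.195] -/
theorem half_sitOfHist_pinOmegaPP
    {D : Setting189 (F.P P.K) (SU N) (MSField (F.P P.K) (SU N) × ((j : ℕ) → VecField (F.P P.K) j (EuclideanSpace ℝ (Fin (N ^ 2 - 1))))) (Pt (F.P P.K).d)}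
    (hD : D = D189OfHist ν P (sitOfHist ν A₁ M Nm P (((((σ.pinOmegaPP s Nm enl).pinLambda s N₀ enl').pinDistAt kd).pinZpp s N₀ Nm enl').pinCubes S) g s N₀ p₁) g) :
    half D = (enl 6 (k' - Nm + 1) (omegaOfChain s (k' - Nm + 1)))ᶜ ∩ omegaOfChain s (k' - Nm) := by
  subst hD; rfl

/-- ★ **THE `j = h` ℍ-DOMAIN IS THE SIXTH CUBE LAYER** (print's range `N > N₀`, p. 179, so that `h + 1 ≤ k₀` and (1.11) gives `Z″_{h+1} = (Ω^{∼5}_{h+1})ᶜ ∩ Z`; memory `N ≤ k′`):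
`domH D = (Ω^{∼6}_{h+1} ∖ Ω^{∼5}_{h+1}) ∩ Z ∩ Ω_h` — p. 199's *«Z″_{h+1}∖(Ω″^∼_{h+1})ᶜ for j = h»* at the objects of record (module 13's `Z″` and this file's `Ω″` over ONE enlargement `enl`).
[cite: Balaban1989LargeFieldI, p.199, (1.11) p.179, p.195] -/
theorem domH_sitOfHist_pinOmegaPP_eq_shell
    {D : Setting189 (F.P P.K) (SU N) (MSField (F.P P.K) (SU N) × ((j : ℕ) → VecField (F.P P.K) j (EuclideanSpace ℝ (Fin (N ^ 2 - 1))))) (Pt (F.P P.K).d)}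
    (hD : D = D189OfHist ν P (sitOfHist ν A₁ M Nm P (((((σ.pinOmegaPP s Nm enl).pinLambda s N₀ enl').pinDistAt kd).pinZpp s N₀ Nm enl).pinCubes S) g s N₀ p₁) g)
    (hNN : N₀ < Nm) (hNk : Nm ≤ k') :
    domH D = (enl 6 (k' - Nm + 1) (omegaOfChain s (k' - Nm + 1)) \ enl 5 (k' - Nm + 1) (omegaOfChain s (k' - Nm + 1))) ∩ σ.Z ∩ omegaOfChain s (k' - Nm) := by
  have hmid : zppOfChain s N₀ Nm σ.Z enl σ.Zpp (k' - Nm + 1) = (enl 5 (k' - Nm + 1) (omegaOfChain s (k' - Nm + 1)))ᶜ ∩ σ.Z :=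
    zppOfChain_mid s N₀ Nm σ.Z enl σ.Zpp (by omega) (by omega)
  subst hD
  exact domH_eq_shell_of _ rfl hmid

/-- **AT `N = N₀` (`h = k₀`) THE `j = h` ℍ-DOMAIN IS EMPTY**: then `h + 1 = k₀ + 1` and (1.10) gives `Z″_{h+1} = (Ω^{∼7}_{h+1})ᶜ ∩ Z ⊆ (Ω″^∼_{h+1})ᶜ` for an enlargement monotone in the
number of layers (`N₀ ≤ k′`). [cite: Balaban1989LargeFieldI, p.199, (1.10) p.179, p.195] -/
theorem domH_sitOfHist_pinOmegaPP_eq_empty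
    {D : Setting189 (F.P P.K) (SU N) (MSField (F.P P.K) (SU N) × ((j : ℕ) → VecField (F.P P.K) j (EuclideanSpace ℝ (Fin (N ^ 2 - 1))))) (Pt (F.P P.K).d)}
    (hD : D = D189OfHist ν P (sitOfHist ν A₁ M N₀ P (((((σ.pinOmegaPP s N₀ enl).pinLambda s N₀ enl').pinDistAt kd).pinZpp s N₀ N₀ enl).pinCubes S) g s N₀ p₁) g)
    (hNk : N₀ ≤ k') (hmono : ∀ j T, enl 6 j T ⊆ enl 7 j T) : domH D = ∅ := by
  have htop : zppOfChain s N₀ N₀ σ.Z enl σ.Zpp (k' + 1 - N₀) = (enl 7 (k' + 1 - N₀) (omegaOfChain s (k' + 1 - N₀)))ᶜ ∩ σ.Z :=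
    zppOfChain_k₀succ s N₀ N₀ σ.Z enl σ.Zpp le_rfl (by omega)
  have e : k' - N₀ + 1 = k' + 1 - N₀ := by omega
  subst hD
  refine domH_eq_empty_of (Z := σ.Z) _ rfl ?_ (hmono _ _)
  show zppOfChain s N₀ N₀ σ.Z enl σ.Zpp (k' - N₀ + 1) = (enl 7 (k' - N₀ + 1) (omegaOfChain s (k' - N₀ + 1)))ᶜ ∩ σ.Z
  rw [e]; exact htop

/-- **THE HALF DOMAIN LIES IN THE CHAIN'S SHELL `Ω_h∖Ω_{h+1}`** for an inflationary enlargement (`Ω_{h+1} ⊆ Ω^{∼6}_{h+1}`). [cite: Balaban1989LargeFieldI, (1.88)–(1.89) p.198, p.195; Balaban1988Convergent, (2.1) p.254] -/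
theorem half_sitOfHist_pinOmegaPP_subset_shell
    {D : Setting189 (F.P P.K) (SU N) (MSField (F.P P.K) (SU N) × ((j : ℕ) → VecField (F.P P.K) j (EuclideanSpace ℝ (Fin (N ^ 2 - 1))))) (Pt (F.P P.K).d)}
    (hD : D = D189OfHist ν P (sitOfHist ν A₁ M Nm P (((((σ.pinOmegaPP s Nm enl).pinLambda s N₀ enl').pinDistAt kd).pinZpp s N₀ Nm enl').pinCubes S) g s N₀ p₁) g)
    (henl : ∀ n j T, T ⊆ enl n j T) : half D ⊆ omegaOfChain s (k' - Nm) \ omegaOfChain s (k' - Nm + 1) := by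
  subst hD
  exact half_subset_shell_of _ rfl (henl 6 _ _)

/-- **THE CHAIN `Ω_{h+1} ⊆ Ω″_{h+1} ⊆ Ω″^∼_{h+1} ⊆ Ω″^{∼2}_{h+1}`** at the pinned letters (`Ω″_{h+1} = Ω^{∼5}_{h+1}`, p. 195), for an enlargement inflationary and monotone in the number of
layers. [cite: Balaban1989LargeFieldI, p.195, (1.12) p.179; Balaban1988Convergent, p.265] -/
theorem omega_subset_OmT_subset_ΩppT2_sitOfHist
    {D : Setting189 (F.P P.K) (SU N) (MSField (F.P P.K) (SU N) × ((j : ℕ) → VecField (F.P P.K) j (EuclideanSpace ℝ (Fin (N ^ 2 - 1))))) (Pt (F.P P.K).d)}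
    (hD : D = D189OfHist ν P (sitOfHist ν A₁ M Nm P (((((σ.pinOmegaPP s Nm enl).pinLambda s N₀ enl').pinDistAt kd).pinZpp s N₀ Nm enl').pinCubes S) g s N₀ p₁) g)
    (henl : ∀ n j T, T ⊆ enl n j T) (hmono : ∀ {m n : ℕ}, m ≤ n → ∀ j T, enl m j T ⊆ enl n j T) :
    D.Ω (D.h + 1) ⊆ enl 5 (D.h + 1) (D.Ω (D.h + 1)) ∧ enl 5 (D.h + 1) (D.Ω (D.h + 1)) ⊆ D.OmT ∧ D.OmT ⊆ enl 7 (D.h + 1) (D.Ω (D.h + 1)) := by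
  subst hD
  exact ⟨henl 5 _ _, hmono (by norm_num) _ _, hmono (by norm_num) _ _⟩

end Term

/-! ## §4. Over the enlargement of record `enlD` (`0 < M`): the same, `henl` ∕ `hmono` discharged -/

section Record

open B15Claim189Assembly (Setting189 half domH)
open B15Claim189PinsOfHistory (D189OfHist sitOfHist)
open B15DeterminingSets (MSField)

variable {F : T4Family} {N : ℕ} [NeZero N] {ν : Stage7Numerics} {A₁ : ℝ} {M : ℕ} (Nm : ℕ) (P : B12.RunParams) (σ : Sit189 F N P.K) {g : ℕ → ℝ} {k' : ℕ}
  (s : SeqOfRecord F ν M g P.K k') (N₀ p₁ kd : ℕ) (S : Set (Site (F.P P.K) 0))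

/-- ★ Over the enlargement of record (one `enlD` for `Ω″`, `Λ`, `Z″`): for `N₀ < N ≤ k′` the `j = h` ℍ-domain is THE SIXTH LAYER of `𝐃_{h+1}`-cubes around `Ω_{h+1}` inside `Z ∩ Ω_h`,
and the half domain lies in `Ω_h∖Ω_{h+1}` (`0 < M`). [cite: Balaban1989LargeFieldI, p.199, (1.11) p.179, p.195, (1.89) p.198; Balaban1988Convergent, (2.1) p.254, p.265] -/
theorem domH_half_sitOfHist_enlD (hM : 0 < M)
    {D : Setting189 (F.P P.K) (SU N) (MSField (F.P P.K) (SU N) × ((j : ℕ) → VecField (F.P P.K) j (EuclideanSpace ℝ (Fin (N ^ 2 - 1))))) (Pt (F.P P.K).d)}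
    (hD : D = D189OfHist ν P (sitOfHist ν A₁ M Nm P (((((σ.pinOmegaPP s Nm (enlD F ν M P g)).pinLambda s N₀ (enlD F ν M P g)).pinDistAt kd).pinZpp s N₀ Nm (enlD F ν M P g)).pinCubes S) g s N₀ p₁) g)
    (hNN : N₀ < Nm) (hNk : Nm ≤ k') :
    domH D = (enlD F ν M P g 6 (k' - Nm + 1) (omegaOfChain s (k' - Nm + 1)) \ enlD F ν M P g 5 (k' - Nm + 1) (omegaOfChain s (k' - Nm + 1))) ∩ σ.Z ∩ omegaOfChain s (k' - Nm) ∧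
      half D ⊆ omegaOfChain s (k' - Nm) \ omegaOfChain s (k' - Nm + 1) :=
  ⟨domH_sitOfHist_pinOmegaPP_eq_shell Nm P σ s N₀ p₁ kd S _ _ hD hNN hNk, half_sitOfHist_pinOmegaPP_subset_shell Nm P σ s N₀ p₁ kd S _ _ hD (subset_enlD hM)⟩

/-- Over the enlargement of record, at `N = N₀` the `j = h` ℍ-domain is empty; the chain `Ω_{h+1} ⊆ Ω^{∼5}_{h+1} ⊆ Ω″^∼_{h+1} ⊆ Ω″^{∼2}_{h+1}` holds (`0 < M`).
[cite: Balaban1989LargeFieldI, p.199, (1.10) p.179, p.195; Balaban1988Convergent, p.265] -/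
theorem domH_empty_chain_sitOfHist_enlD (hM : 0 < M)
    {D : Setting189 (F.P P.K) (SU N) (MSField (F.P P.K) (SU N) × ((j : ℕ) → VecField (F.P P.K) j (EuclideanSpace ℝ (Fin (N ^ 2 - 1))))) (Pt (F.P P.K).d)}
    (hD : D = D189OfHist ν P (sitOfHist ν A₁ M N₀ P (((((σ.pinOmegaPP s N₀ (enlD F ν M P g)).pinLambda s N₀ (enlD F ν M P g)).pinDistAt kd).pinZpp s N₀ N₀ (enlD F ν M P g)).pinCubes S) g s N₀ p₁) g)
    (hNk : N₀ ≤ k') :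
    domH D = ∅ ∧ (D.Ω (D.h + 1) ⊆ enlD F ν M P g 5 (D.h + 1) (D.Ω (D.h + 1)) ∧ enlD F ν M P g 5 (D.h + 1) (D.Ω (D.h + 1)) ⊆ D.OmT ∧
      D.OmT ⊆ enlD F ν M P g 7 (D.h + 1) (D.Ω (D.h + 1))) :=
  ⟨domH_sitOfHist_pinOmegaPP_eq_empty P σ s N₀ p₁ kd S _ _ hD hNk (fun j T => enlD_mono_layers (by norm_num) j T),
    omega_subset_OmT_subset_ΩppT2_sitOfHist N₀ P σ s N₀ p₁ kd S _ _ hD (subset_enlD hM) (fun hmn j T => enlD_mono_layers hmn j T)⟩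

end Record

/-! ## §5. THE (1.89) DISPLAY AT THE Ω″- AND SIDE-PINNED SITUATION — module 16's theorems with EVERY region letter except `Z` and the interpolated `Z″_j` an object of record -/

section Display

open B15 (Ineq180)
open B15.BasicStep (Claim189)
open B15.PrelimIntegrations (Ineq191 Ineq195)
open B15Chi124DetSets (E124)
open B15DeterminingSets (MSField)
open B15Claim189Assembly (Setting189 new189 chiPP dom half)
open B15Claim189PinsOfHistory (D189OfHist sitOfHist N0OfRecord₁₃)
open B15Claim189N0OfRecord (N0OfSeq)
open B15Claim189LambdaPin (claim189_sitOfHist_Λ_of_flow claim189_sitOfHist₁₃_Λ_of_inInterval)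
open GaugeGroup (dist1)
open GaugeField (plaqHol)
open FlowStep (HBeta prefixOf BetaUpperH)
open FlowStepRuns (genSeq)
open B14FlowStep (SmallnessFor)

variable {F : T4Family} {N : ℕ} [NeZero N] {ν : Stage7Numerics} {A₁ : ℝ} {M : ℕ} (Nm : ℕ) (P : B12.RunParams) (σ : Sit189 F N P.K) {g : ℕ → ℝ} {k' : ℕ}
  (s : SeqOfRecord F ν M g P.K k') (p₁ : ℕ)

/-- ★★★ **(1.89) AT THE TERM'S FULLY PINNED SITUATION WITH `Ω″^∼_{h+1} = Ω^{∼6}_{h+1}`, `Ω″^{∼2}_{h+1} = Ω^{∼7}_{h+1}` (p. 195) AND THE `LM₂R`-CUBE SIDES (p. 178) PINNED TOO** — module 16's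
`claim189_sitOfHist_Λ_of_flow` VERBATIM at `σ := (σ.pinSides ν g (k′−N) k′).pinOmegaPP s N enlD` (window-free form; `N₀ := N0OfSeq L r g k′`): `Claim189 (new189 D) (chiPP D)` for the
letters `D` of the stack `pinSides → pinOmegaPP → pinLambda → pinDistAt → pinZpp → pinCubes → (term, levels, χ′, dev0)`.  Now the half domain, the `j = h` ℍ-domain, the comparison
configuration's region `Ω″^{∼2}_{h+1}`, the (1.82) bond region `Λ₀` and BOTH cube geometries read objects of record; `0 < sh` became `0 < M₂`.  DISPLAYED remain: `1 < (log g_{k′}⁻²)^r`,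
`N₀ ≤ N`, `N₀ ≤ k′`; residual numerics `0 ≤ β ≤ 1/4`, `2 ≤ L₀`, `L₀² ≤ L`, signs, `0 < M₂`, `0 < M`; print's two p. 200 conditions; the flow inputs; one step of monotone couplings;
`Λ ≠ ∅`; the four ℍ-leaves and (1.80) — over the RESIDUAL letters `Z`, the interpolated `Z″_j`, `XH`, `XΩ4`, the numbers `β, L₀, δ, B₃, B₅, O(1)`, the deviation letters `devV″, dev97` and the
exponent `p₁`. [cite: Balaban1989LargeFieldI, (1.89) p.198, p.195, p.178, (1.73) p.192, (1.10)–(1.12) p.179, (1.80) p.195, (1.88) p.198, pp.199–200; Balaban1988Convergent, (2.1) p.254, (2.5)–(2.8) pp.255–256, (2.17) p.257] -/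
theorem claim189_sitOfHist_ΛΩ_of_flow (hM₂ : 0 < ν.M₂) (hM : 0 < M)
    {D : Setting189 (F.P P.K) (SU N) (MSField (F.P P.K) (SU N) × ((j : ℕ) → VecField (F.P P.K) j (EuclideanSpace ℝ (Fin (N ^ 2 - 1))))) (Pt (F.P P.K).d)}
    (hD : D = D189OfHist ν P (sitOfHist ν A₁ M Nm P
      ((((((σ.pinSides ν g (k' - Nm) k').pinOmegaPP s Nm (enlD F ν M P g)).pinLambda s (N0OfSeq (F.P P.K).L ν.r g k') (enlD F ν M P g)).pinDistAt k').pinZpp s (N0OfSeq (F.P P.K).L ν.r g k') Nm (enlD F ν M P g)).pinCubes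
        ((((((σ.pinSides ν g (k' - Nm) k').pinOmegaPP s Nm (enlD F ν M P g)).pinLambda s (N0OfSeq (F.P P.K).L ν.r g k') (enlD F ν M P g)).pinDistAt k').pinZpp s (N0OfSeq (F.P P.K).L ν.r g k') Nm (enlD F ν M P g)).OmTᶜ ∩
          omegaOfChain s (k' - Nm))) g s (N0OfSeq (F.P P.K).L ν.r g k') p₁) g)
    (hlog : 1 < (Real.log (g k' ^ 2)⁻¹) ^ ν.r) (hNN : N0OfSeq (F.P P.K).L ν.r g k' ≤ Nm) (hNk : N0OfSeq (F.P P.K).L ν.r g k' ≤ k')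
    (hβ0 : 0 ≤ σ.β) (hβ : σ.β ≤ 1 / 4) (hL₀ : 2 ≤ σ.L₀) (hL₀L : σ.L₀ ^ 2 ≤ ((F.P P.K).L : ℝ))
    (hB : 0 ≤ σ.O1 * σ.B₃ * σ.B₅) (hδ : 0 ≤ σ.δ)
    (hN₀ : (2 + (121 / 120) ^ 2 * (σ.O1 * σ.B₃ * σ.B₅ * (M : ℝ) ^ 5)) * ((σ.L₀ ^ 2) ^ (N0OfSeq (F.P P.K).L ν.r g k' - 1))⁻¹ ≤ 1 / 4)
    (hMl : (121 / 120) ^ 2 * (σ.O1 * σ.B₃ * σ.B₅ * (M : ℝ) ^ 5) * Real.exp (-(4 * σ.δ * (M : ℝ))) ≤ 1 / 12)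
    (hε0 : ∀ i, k' - Nm ≤ i → i ≤ k' → 0 ≤ epsOfRecord ν g i) (hε1 : ∀ i, k' - Nm ≤ i → i ≤ k' → epsOfRecord ν g i ≤ 1 / 10)
    {β₀ : ℝ} (hβ₀0 : 0 ≤ β₀) (hβ₀ : β₀ ≤ 1 / 2)
    (hflow : ∀ j, k' - Nm ≤ j → j < k' → epsOfRecord ν g k' ≤ (1 + β₀) * Real.sqrt ((k' - j : ℕ) : ℝ) * epsOfRecord ν g j)
    (hgpos : 0 < g (k' + 1 - N0OfSeq (F.P P.K).L ν.r g k')) (hgstep : g (k' + 1 - N0OfSeq (F.P P.K).L ν.r g k') ≤ g (k' + 2 - N0OfSeq (F.P P.K).L ν.r g k'))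
    (hgle : g (k' + 2 - N0OfSeq (F.P P.K).L ν.r g k') ≤ 1)
    (hΛ : ((enlD F ν M P g 4 (k' + 1 - N0OfSeq (F.P P.K).L ν.r g k') (omegaOfChain s (k' + 1 - N0OfSeq (F.P P.K).L ν.r g k')))ᶜ ∩ σ.Z).Nonempty)
    (L91h : ∀ U, new189 D U → ∀ p ∈ plaqsOf (half D),
      Ineq191 (dist1 (plaqHol (D.Upp U) p)) (D.devV'' U p) D.α ((D.L ^ D.h)⁻¹) (D.ε D.h) (E124 D.ε D.L D.η D.k D.h))
    (L95 : ∀ U, new189 D U → ∀ p ∈ plaqsOf (half D),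
      Ineq195 (D.devV'' U p) (dist1 (plaqHol (D.Uhalf U (D.boxOf p)) p)) D.α ((D.L ^ D.h)⁻¹) (D.ε D.h) (E124 D.ε D.L D.η D.k D.h))
    (L91 : ∀ U, new189 D U → ∀ j, D.h ≤ j → j ≤ D.k → ∀ p ∈ plaqsOf (dom D j),
      Ineq191 (dist1 (plaqHol (D.Upp U) p)) (D.dev97 U p) D.α ((D.L ^ j)⁻¹) (D.ε j) (E124 D.ε D.L D.η D.k j))
    (L97 : ∀ U, new189 D U → ∀ j, D.h ≤ j → j ≤ D.k → ∀ p ∈ plaqsOf (dom D j),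
      Ineq191 (D.dev97 U p) (D.dev0 U p) D.α ((D.L ^ j)⁻¹) (D.ε j) (E124 D.ε D.L D.η D.k j))
    (L80 : ∀ U, new189 D U → ∀ j, D.h ≤ j → j ≤ D.k → ∀ p ∈ plaqsOf (dom D j),
      Ineq180 (D.dev0 U p) (D.ε D.k) D.η D.B₃ D.B₅ D.M D.δ (D.dist p) D.O1) :
    Claim189 (new189 D) (chiPP D) :=
  claim189_sitOfHist_Λ_of_flow Nm P ((σ.pinSides ν g (k' - Nm) k').pinOmegaPP s Nm (enlD F ν M P g)) s p₁
    (pinSides_sh_pos σ ν g (k' - Nm) k' hM₂).1 hM hD hlog hNN hNk hβ0 hβ hL₀ hL₀L hB hδ hN₀ hMl hε0 hε1 hβ₀0 hβ₀ hflow hgpos hgstep hgle hΛ L91h L95 L91 L97 L80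

variable {θ : Stage13Params F N} (s₁₃ : SeqOfRecord F θ.ν θ.τ9.M (gOfRecord₁₃ F N θ P) P.K k')

/-- ★★★ **THE SAME AT RECORD 13, IN THE RUN'S (2.7)-SMALL WINDOW** — module 16's `claim189_sitOfHist₁₃_Λ_of_inInterval` VERBATIM at `σ := (σ.pinSides θ.ν (gOfRecord₁₃ θ P) (k′−N) k′).pinOmegaPP
s N enlD` (`N₀ := N0OfRecord₁₃ θ P k′`): the half domain, the `j = h` ℍ-domain, `Ω″^{∼2}_{h+1}` and both cube geometries are objects of Record 13; `0 < sh` became `0 < θ.ν.M₂`.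
DISPLAYED: memory `N ≥ N₀(P)`, `N₀(P) ≤ k′`, residual numerics ∕ signs, `0 < M₂`, `0 < M`, print's second condition, the window (`S`, `hI`, `hup`, `hε10`, `hA₀`, `r ≥ 1`, one threshold
`hwin`, `β₁₃ ≥ 0`), `Λ ≠ ∅`, the four ℍ-leaves and (1.80).
[cite: Balaban1989LargeFieldI, (1.89) p.198, p.195, p.178, (1.73) p.192, pp.199–200; Balaban1988Convergent, (2.1) p.254, (2.4)–(2.8) pp.255–256, (2.17) p.257; Balaban1987RG1, (0.20) p.256, §1 p.264] -/
theorem claim189_sitOfHist₁₃_ΛΩ_of_inInterval (hM₂ : 0 < θ.ν.M₂) (hM : 0 < θ.τ9.M)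
    {D : Setting189 (F.P P.K) (SU N) (MSField (F.P P.K) (SU N) × ((j : ℕ) → VecField (F.P P.K) j (EuclideanSpace ℝ (Fin (N ^ 2 - 1))))) (Pt (F.P P.K).d)}
    (hD : D = D189OfHist θ.ν P (sitOfHist θ.ν θ.A₁ θ.τ9.M Nm P
      ((((((σ.pinSides θ.ν (gOfRecord₁₃ F N θ P) (k' - Nm) k').pinOmegaPP s₁₃ Nm (enlD F θ.ν θ.τ9.M P (gOfRecord₁₃ F N θ P))).pinLambda s₁₃ (N0OfRecord₁₃ θ P k') (enlD F θ.ν θ.τ9.M P (gOfRecord₁₃ F N θ P))).pinDistAt k').pinZpp s₁₃ (N0OfRecord₁₃ θ P k') Nm (enlD F θ.ν θ.τ9.M P (gOfRecord₁₃ F N θ P))).pinCubes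
        ((((((σ.pinSides θ.ν (gOfRecord₁₃ F N θ P) (k' - Nm) k').pinOmegaPP s₁₃ Nm (enlD F θ.ν θ.τ9.M P (gOfRecord₁₃ F N θ P))).pinLambda s₁₃ (N0OfRecord₁₃ θ P k') (enlD F θ.ν θ.τ9.M P (gOfRecord₁₃ F N θ P))).pinDistAt k').pinZpp s₁₃ (N0OfRecord₁₃ θ P k') Nm (enlD F θ.ν θ.τ9.M P (gOfRecord₁₃ F N θ P))).OmTᶜ ∩
          omegaOfChain s₁₃ (k' - Nm))) (gOfRecord₁₃ F N θ P) s₁₃ (N0OfRecord₁₃ θ P k') p₁) (gOfRecord₁₃ F N θ P))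
    (hr : 1 ≤ θ.ν.r) (hNN : (N0OfRecord₁₃ θ P k') ≤ Nm) (hNk : (N0OfRecord₁₃ θ P k') ≤ k')
    (hβ0 : 0 ≤ σ.β) (hβ : σ.β ≤ 1 / 4) (hL₀ : 2 ≤ σ.L₀) (hL₀L : σ.L₀ ^ 2 ≤ ((F.P P.K).L : ℝ))
    (hB : 0 ≤ σ.O1 * σ.B₃ * σ.B₅) (hδ : 0 ≤ σ.δ)
    (hwin : 4 * (2 + (121 / 120) ^ 2 * (σ.O1 * σ.B₃ * σ.B₅ * (θ.τ9.M : ℝ) ^ 5))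
      ≤ ((Real.log ((gOfRecord₁₃ F N θ P) k' ^ 2)⁻¹) ^ θ.ν.r) ^ (Real.log (σ.L₀ ^ 2) / Real.log ((F.P P.K).L : ℝ)))
    (hβhist : ∀ j, j < k' → 0 ≤ betaOfRecord₁₃ F N θ j (prefixOf (gOfRecord₁₃ F N θ P) j))
    (hMl : (121 / 120) ^ 2 * (σ.O1 * σ.B₃ * σ.B₅ * (θ.τ9.M : ℝ) ^ 5) * Real.exp (-(4 * σ.δ * (θ.τ9.M : ℝ))) ≤ 1 / 12)
    (hA₀ : 0 ≤ θ.ν.A₀) {β' β₀ : ℝ} {L : ℕ} (S : SmallnessFor θ.γ β' β₀ L θ.ν.p₀) (hβ₀ : β₀ ≤ 1 / 2) (hε10 : θ.γ * p0Profile θ.ν.A₀ θ.ν.p₀ θ.γ ≤ 1 / 10)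
    (hI : Step.InInterval θ.γ k' (gOfRecord₁₃ F N θ P)) (hup : BetaUpperH β' θ.γ (betaOfRecord₁₃ F N θ))
    (hΛ : (((enlD F θ.ν θ.τ9.M P (gOfRecord₁₃ F N θ P)) 4 (k' + 1 - (N0OfRecord₁₃ θ P k')) (omegaOfChain s₁₃ (k' + 1 - (N0OfRecord₁₃ θ P k'))))ᶜ ∩ σ.Z).Nonempty)
    (L91h : ∀ U, new189 D U → ∀ p ∈ plaqsOf (half D),
      Ineq191 (dist1 (plaqHol (D.Upp U) p)) (D.devV'' U p) D.α ((D.L ^ D.h)⁻¹) (D.ε D.h) (E124 D.ε D.L D.η D.k D.h))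
    (L95 : ∀ U, new189 D U → ∀ p ∈ plaqsOf (half D),
      Ineq195 (D.devV'' U p) (dist1 (plaqHol (D.Uhalf U (D.boxOf p)) p)) D.α ((D.L ^ D.h)⁻¹) (D.ε D.h) (E124 D.ε D.L D.η D.k D.h))
    (L91 : ∀ U, new189 D U → ∀ j, D.h ≤ j → j ≤ D.k → ∀ p ∈ plaqsOf (dom D j),
      Ineq191 (dist1 (plaqHol (D.Upp U) p)) (D.dev97 U p) D.α ((D.L ^ j)⁻¹) (D.ε j) (E124 D.ε D.L D.η D.k j))
    (L97 : ∀ U, new189 D U → ∀ j, D.h ≤ j → j ≤ D.k → ∀ p ∈ plaqsOf (dom D j),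
      Ineq191 (D.dev97 U p) (D.dev0 U p) D.α ((D.L ^ j)⁻¹) (D.ε j) (E124 D.ε D.L D.η D.k j))
    (L80 : ∀ U, new189 D U → ∀ j, D.h ≤ j → j ≤ D.k → ∀ p ∈ plaqsOf (dom D j),
      Ineq180 (D.dev0 U p) (D.ε D.k) D.η D.B₃ D.B₅ D.M D.δ (D.dist p) D.O1) :
    Claim189 (new189 D) (chiPP D) :=
  claim189_sitOfHist₁₃_Λ_of_inInterval Nm P ((σ.pinSides θ.ν (gOfRecord₁₃ F N θ P) (k' - Nm) k').pinOmegaPP s₁₃ Nm (enlD F θ.ν θ.τ9.M P (gOfRecord₁₃ F N θ P))) s₁₃ p₁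
    (pinSides_sh_pos σ θ.ν (gOfRecord₁₃ F N θ P) (k' - Nm) k' hM₂).1 hM hD hr hNN hNk hβ0 hβ hL₀ hL₀L hB hδ hwin hβhist hMl hA₀ S hβ₀ hε10 hI hup hΛ L91h L95 L91 L97 L80

end Display

/-! ## §6. For dag-n12-d's λ-layer `ResidW.pinD189ΛH` (module 16 §9) with `σT` PRE-PINNED by §2: the letters by `rfl` — NO new layer name -/

section Layer

open B15Claim189Assembly (Setting189 half domH)
open B15Claim189PinsOfHistory (D189OfHist sitOfHist)
open B15Claim189N0OfRecord (N0OfSeq)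

variable {F : T4Family} {N : ℕ} [NeZero N]
variable (lam : ResidW F N) (ν : Stage7Numerics) (A₁ : ℝ) (M : ℕ) (gT : B12.RunParams → ℕ → ℝ) (σT : ∀ P : B12.RunParams, Sit189 F N P.K)
  (sT : ∀ P : B12.RunParams, SeqOfRecord F ν M (gT P) P.K (lam.kSel P + 1)) (NmT : B12.RunParams → ℕ) (p₁ : ℕ)

/-- **THE `Λ`-PINNED LAYER OVER Ω″- AND SIDE-PINNED SITUATIONS READS THE PINNED LETTERS** (`rfl` ×3): at `σT P := ((σ P).pinSides ν (g P) (k−N P) k).pinOmegaPP (s P) (N P) enlD`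
(`k = kSel P + 1`), the run's `Ω″^∼_{h+1}` is `Ω^{∼6}_{h+1}` of the term's chain over the enlargement of record, `h = k − N P`, and the half domain is `(Ω^{∼6}_{h+1})ᶜ ∩ Ω_h` (the situation's
`Ω″^{∼2}_{h+1}` and cube sides by `sitOfHist_pinOmegaPP_regions`) — dag-n12-d instantiates its `σT` so; nothing of module 16 §9 changes. [cite: Balaban1989LargeFieldI, p.195, p.178, (1.89) p.198 (bookkeeping)] -/
theorem pinD189ΛH_letters_pre (P : B12.RunParams) :
    ((lam.pinD189ΛH ν A₁ M gT (fun P => ((σT P).pinSides ν (gT P) (lam.kSel P + 1 - NmT P) (lam.kSel P + 1)).pinOmegaPP (sT P) (NmT P) (enlD F ν M P (gT P))) sT NmT p₁).D189 P).OmT =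
        enlD F ν M P (gT P) 6 (lam.kSel P + 1 - NmT P + 1) (omegaOfChain (sT P) (lam.kSel P + 1 - NmT P + 1)) ∧
    ((lam.pinD189ΛH ν A₁ M gT (fun P => ((σT P).pinSides ν (gT P) (lam.kSel P + 1 - NmT P) (lam.kSel P + 1)).pinOmegaPP (sT P) (NmT P) (enlD F ν M P (gT P))) sT NmT p₁).D189 P).h =
        lam.kSel P + 1 - NmT P ∧
    half ((lam.pinD189ΛH ν A₁ M gT (fun P => ((σT P).pinSides ν (gT P) (lam.kSel P + 1 - NmT P) (lam.kSel P + 1)).pinOmegaPP (sT P) (NmT P) (enlD F ν M P (gT P))) sT NmT p₁).D189 P) =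
        (enlD F ν M P (gT P) 6 (lam.kSel P + 1 - NmT P + 1) (omegaOfChain (sT P) (lam.kSel P + 1 - NmT P + 1)))ᶜ ∩ omegaOfChain (sT P) (lam.kSel P + 1 - NmT P) :=
  ⟨rfl, rfl, rfl⟩

/-- ★ **AT THE PRE-PINNED λ-LAYER THE RUN's `j = h` ℍ-DOMAIN IS THE SIXTH CUBE LAYER** (`N₀(P) < N P ≤ kSel P + 1`): the domain over which dag-n12-d's `h180` slot and the p. 199 leaves at
`j = h` are quantified is `(Ω^{∼6}_{h+1} ∖ Ω^{∼5}_{h+1}) ∩ Z ∩ Ω_h` of the run's term. [cite: Balaban1989LargeFieldI, p.199, (1.11) p.179, p.195] -/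
theorem pinD189ΛH_domH_pre (P : B12.RunParams) (hNN : N0OfSeq (F.P P.K).L ν.r (gT P) (lam.kSel P + 1) < NmT P) (hNk : NmT P ≤ lam.kSel P + 1) :
    domH ((lam.pinD189ΛH ν A₁ M gT (fun P => ((σT P).pinSides ν (gT P) (lam.kSel P + 1 - NmT P) (lam.kSel P + 1)).pinOmegaPP (sT P) (NmT P) (enlD F ν M P (gT P))) sT NmT p₁).D189 P) =
      (enlD F ν M P (gT P) 6 (lam.kSel P + 1 - NmT P + 1) (omegaOfChain (sT P) (lam.kSel P + 1 - NmT P + 1)) \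
          enlD F ν M P (gT P) 5 (lam.kSel P + 1 - NmT P + 1) (omegaOfChain (sT P) (lam.kSel P + 1 - NmT P + 1))) ∩ (σT P).Z ∩ omegaOfChain (sT P) (lam.kSel P + 1 - NmT P) :=
  domH_sitOfHist_pinOmegaPP_eq_shell (NmT P) P ((σT P).pinSides ν (gT P) (lam.kSel P + 1 - NmT P) (lam.kSel P + 1)) (sT P) _ p₁ _ _ _ _ rfl hNN hNk

end Layer

/-! ## §7. CENSUS (A2): the pinned `Ω″`-letters are void at `M = 0`, the pinned sides at `M₂ = 0` -/

section Census

open B15Claim189Assembly (Setting189 half)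
open B15Claim189PinsOfHistory (D189OfHist sitOfHist)
open B15DeterminingSets (MSField)

variable {F : T4Family} {N : ℕ} [NeZero N] {ν : Stage7Numerics} {A₁ : ℝ} (Nm : ℕ) (P : B12.RunParams) (σ : Sit189 F N P.K) {g : ℕ → ℝ} {k' : ℕ}

/-- CENSUS (A2): at `M = 0` the enlargement of record is `∅` (module 16 §8), so the pinned `Ω″^∼_{h+1}`, `Ω″^{∼2}_{h+1}` are EMPTY and the half domain is ALL of `Ω_h` — the displayed `0 < M`
is load-bearing for this pin as well. [cite: Balaban1989LargeFieldI, p.195, (1.89) p.198 (bookkeeping census)] -/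
theorem pinOmegaPP_of_M_eq_zero (s : SeqOfRecord F ν 0 g P.K k') (N₀ p₁ kd : ℕ) (S : Set (Site (F.P P.K) 0))
    {D : Setting189 (F.P P.K) (SU N) (MSField (F.P P.K) (SU N) × ((j : ℕ) → VecField (F.P P.K) j (EuclideanSpace ℝ (Fin (N ^ 2 - 1))))) (Pt (F.P P.K).d)}
    (hD : D = D189OfHist ν P (sitOfHist ν A₁ 0 Nm P (((((σ.pinOmegaPP s Nm (enlD F ν 0 P g)).pinLambda s N₀ (enlD F ν 0 P g)).pinDistAt kd).pinZpp s N₀ Nm (enlD F ν 0 P g)).pinCubes S) g s N₀ p₁) g) :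
    D.OmT = ∅ ∧ (σ.pinOmegaPP s Nm (enlD F ν 0 P g)).ΩppT2 = ∅ ∧ half D = omegaOfChain s (k' - Nm) := by
  subst hD
  refine ⟨enlD_of_M_eq_zero ν P g 6 _ _, enlD_of_M_eq_zero ν P g 7 _ _, ?_⟩
  rw [half_sitOfHist_pinOmegaPP Nm P σ s N₀ p₁ kd S _ _ rfl, enlD_of_M_eq_zero ν P g 6, Set.compl_empty, Set.univ_inter]

/-- CENSUS (A2): at `M₂ = 0` the pinned sides are `0` (a degenerate cube geometry) — `0 < M₂` is what §5 displays instead of `0 < sh`. [cite: Balaban1988Convergent, (2.17) p.257 (bookkeeping census)] -/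
theorem pinSides_of_M₂_eq_zero {K : ℕ} (σ₀ : Sit189 F N K) (ν₀ : Stage7Numerics) (hM₂ : ν₀.M₂ = 0) (g₀ : ℕ → ℝ) (h k : ℕ) :
    (σ₀.pinSides ν₀ g₀ h k).sh = 0 ∧ (σ₀.pinSides ν₀ g₀ h k).sk = 0 := by
  refine ⟨?_, ?_⟩ <;> simp [Sit189.pinSides, cubeSide, hM₂]

end Census

end B15Claim189OmegaPPPin

end Literature.MathematicalPhysics.QuantumFieldTheory.Balaban1983to89
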